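import Summits.ABC.IUTFork.Cor312HullGainRamifiedSharp
import Summits.ABC.IUTFork.Thm311RealIsmDHOrbitSpan
import HarnessLib

/-!
# [IUTchIII] Cor. 3.12, (Ind2) at one factor — a shell-preserving lattice automorphism of `F_v` that EXPANDS a vector by
# the factor `p^{(e_v−1)/e_v}` (every place, every ramification index): the mover for the all-labels hull gain

PROOF-ONLY file (abc-iut cell, Cor. 3.12 sub-crew, seat abc-iut-c312-5, gen 5; row «RAMIFIED-GAIN», mover upgrade);
TAKES NO SIDE on [IUTchIII] Cor. 3.12; no definition, no `Prop` fact, no instance. The parent files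
(`Cor312HullGainRamified*`, p439709/p440607/p441445/p442092) expand a vector by SOME factor `> 1`, i.e. `≥ p^{1/e_v}`, and
therefore need the label bound `e_v ≤ i+2` to amplify past one `p`-power on the `(i+2)`-fold packet. THIS FILE supplies
the better mover: Dupuy–Hilado's (Ind2) group `Real.ismDH logv v` (ALL shell-preserving lattice automorphisms, §4.9) acts
TRANSITIVELY on the primitive vectors of the log-shell lattice `I_v = (p^*)⁻¹·log_p(𝒪_v^×)` (abc-iut-w5-d180
`exists_mem_ismDH_apply_eq_of_primitive`, Weil *BNT* II §2 Th. 1), and `I_v` has primitive vectors in EVERY class of the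
value group `p^{(1/e)ℤ}` modulo `p^ℤ` (rescale `ϖ^j`, `j < e`, by the least `p`-power putting it in `I_v`); `e` integers
with distinct residues mod `e` spread over `≥ e−1`, so two primitive vectors have norm ratio `≥ p^{(e−1)/e}`:

* `toNat_spread_of_injective` — `e` pairwise distinct integers have `max − min ≥ e − 1`;
* `exists_zpow_smul_mem_and_not_mem` — least `p`-power scaling of a non-zero vector into a lattice (open, bounded);
* **`exists_mem_ismDH_rpow_mul_norm_le`** — at EVERY place `v | p`: `∃ g ∈ Real.ismDH logv v` (with its `ℚ_p`-linear
  form `g'` on `F_v` and the intertwining through the presentation) and `z ≠ 0` with `p^{(e_v−1)/e_v}·‖z‖ ≤ ‖g' z‖`;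
* `p_mul_pow_norm_le_of_two_le` — hence `p·‖z‖^N ≤ ‖g' z‖^N` for every `N ≥ 2` as soon as `e_v ≥ 2` (no `e_v ≤ N`).
[cite: DupuyHilado2025, §4.9] [cite: NeukirchANT1999, Ch. II Prop. (5.5)] [claim: Mochizuki2012, status: disputed]
HONEST SCOPE: Dupuy–Hilado's (Ind2); a statement about the typed objects only.
-/

noncomputable section

open Set Function NumberField IsDedekindDomain Metric Filter Topology
open scoped Pointwise

namespace Summit.ABC

namespace IUTFork

namespace Thm311

namespace Real

open Cor312 Cor312Vol Literature.IUT.LogThetaLattice Literature.IUT.LogVolume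

/-! ## §0. Bookkeeping -/

/-- **`e` pairwise distinct integers spread over at least `e − 1`**: if `n : Fin e → ℤ` is injective, `n j ≤ n jmax` and
`n jmin ≤ n j` for all `j`, then `e − 1 ≤ n jmax − n jmin`. [folklore] -/
theorem toNat_spread_of_injective {e : ℕ} (n : Fin e → ℤ) (hn : Function.Injective n) (jmax jmin : Fin e)
    (hmax : ∀ j, n j ≤ n jmax) (hmin : ∀ j, n jmin ≤ n j) : (e : ℤ) - 1 ≤ n jmax - n jmin := by
  classical
  have hsub : Finset.univ.image n ⊆ Finset.Icc (n jmin) (n jmax) := by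
    intro z hz
    obtain ⟨j, -, rfl⟩ := Finset.mem_image.mp hz
    exact Finset.mem_Icc.mpr ⟨hmin j, hmax j⟩
  have hcard := Finset.card_le_card hsub
  rw [Finset.card_image_of_injective _ hn, Finset.card_univ, Fintype.card_fin, Int.card_Icc] at hcard
  have h0 : 0 ≤ n jmax + 1 - n jmin := by linarith [hmin jmax]
  have h1 : (e : ℤ) ≤ n jmax + 1 - n jmin := by
    have := Int.toNat_of_nonneg h0
    omega
  linarith

/-- **`p`-power amplification without a label bound**: `p^{(e−1)/e}·‖x‖ ≤ ‖y‖`, `2 ≤ e`, `2 ≤ N` ⇒ `p·‖x‖^N ≤ ‖y‖^N`.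
[folklore] -/
theorem p_mul_pow_norm_le_of_two_le (p : ℕ) [Fact p.Prime] {K : Type*} [NormedField K] {x y : K} {e N : ℕ}
    (he : 2 ≤ e) (hN : 2 ≤ N) (h : (p : ℝ) ^ (((e : ℝ) - 1) / (e : ℝ)) * ‖x‖ ≤ ‖y‖) :
    (p : ℝ) * ‖x‖ ^ N ≤ ‖y‖ ^ N := by
  have hp1 : (1 : ℝ) ≤ p := by exact_mod_cast (Fact.out : p.Prime).one_lt.le
  have hp0 : (0 : ℝ) ≤ p := zero_le_one.trans hp1
  have hpow := pow_le_pow_left₀ (by positivity) h N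
  rw [mul_pow, ← Real.rpow_natCast, ← Real.rpow_mul hp0] at hpow
  refine le_trans (mul_le_mul_of_nonneg_right ?_ (by positivity)) hpow
  have he0 : (0 : ℝ) < e := by exact_mod_cast (lt_of_lt_of_le (by norm_num) he : 0 < e)
  have hexp : (1 : ℝ) ≤ ((e : ℝ) - 1) / (e : ℝ) * (N : ℝ) := by
    rw [div_mul_eq_mul_div, le_div_iff₀ he0, one_mul]
    have h2e : (2 : ℝ) ≤ e := by exact_mod_cast he
    have h2N : (2 : ℝ) ≤ N := by exact_mod_cast hN
    nlinarith
  calc (p : ℝ) = (p : ℝ) ^ (1 : ℝ) := (Real.rpow_one _).symm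
    _ ≤ (p : ℝ) ^ (((e : ℝ) - 1) / (e : ℝ) * (N : ℝ)) := Real.rpow_le_rpow_of_exponent_le hp1 hexp

/-- **Least `p`-power scaling of a non-zero vector into a lattice**: for a neighbourhood `L` of `0` that is bounded and
`u ≠ 0`, some `p^m·u` lies in `L` while `p^{m−1}·u` does not. [folklore] -/
theorem exists_zpow_smul_mem_and_not_mem (p : ℕ) [Fact p.Prime] {K : Type*} [NormedAddCommGroup K]
    [NormedSpace ℚ_[p] K] {L : Set K} (hL0 : L ∈ 𝓝 (0 : K)) (hLb : Bornology.IsBounded L) {u : K} (hu : u ≠ 0) :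
    ∃ m : ℤ, ((p : ℚ_[p]) ^ m) • u ∈ L ∧ ((p : ℚ_[p]) ^ (m - 1)) • u ∉ L := by
  have hp1 : (1 : ℝ) < p := by exact_mod_cast (Fact.out : p.Prime).one_lt
  have hp0 : (0 : ℝ) < p := zero_lt_one.trans hp1
  have hnorm : ∀ m : ℤ, ‖((p : ℚ_[p]) ^ m) • u‖ = (p : ℝ) ^ (-m) * ‖u‖ := fun m => by
    rw [norm_smul, norm_zpow, Padic.norm_p, inv_zpow']
  have hu0 : 0 < ‖u‖ := norm_pos_iff.mpr hu
  -- some `p^m·u ∈ L` (`L` is a neighbourhood of `0`)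
  obtain ⟨r, hr, hball⟩ := Metric.mem_nhds_iff.mp hL0
  obtain ⟨N₁, hN₁⟩ := pow_unbounded_of_one_lt (‖u‖ / r) hp1
  have hmem : ((p : ℚ_[p]) ^ (N₁ : ℤ)) • u ∈ L := by
    refine hball (mem_ball_zero_iff.mpr ?_)
    rw [hnorm, zpow_neg, zpow_natCast, inv_mul_lt_iff₀ (pow_pos hp0 _)]
    rwa [div_lt_iff₀ hr] at hN₁
  -- and the admissible exponents are bounded below (`L` is bounded)
  obtain ⟨R, hR⟩ := hLb.exists_norm_le
  obtain ⟨N₂, hN₂⟩ := pow_unbounded_of_one_lt (R / ‖u‖) hp1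
  have hbdd : ∀ m : ℤ, ((p : ℚ_[p]) ^ m) • u ∈ L → -(N₂ : ℤ) ≤ m := by
    intro m hm
    by_contra hlt
    push Not at hlt
    have hle := hR _ hm
    rw [hnorm] at hle
    have hgt : (p : ℝ) ^ (N₂ : ℤ) ≤ (p : ℝ) ^ (-m) := zpow_le_zpow_right₀ hp1.le (by omega)
    rw [zpow_natCast] at hgt
    have : R / ‖u‖ < R / ‖u‖ :=
      calc R / ‖u‖ < (p : ℝ) ^ N₂ := hN₂
        _ ≤ (p : ℝ) ^ (-m) := hgt
        _ ≤ R / ‖u‖ := by rw [le_div_iff₀ hu0]; exact hle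
    exact lt_irrefl _ this
  obtain ⟨m, hm, hleast⟩ := Int.exists_least_of_bdd ⟨-(N₂ : ℤ), hbdd⟩ ⟨(N₁ : ℤ), hmem⟩
  exact ⟨m, hm, fun h => by have := hleast _ h; omega⟩

/-! ## §1. The mover with expansion factor `p^{(e−1)/e}` -/

variable {F : Type} [Field F] [NumberField F] (X : PilotData F) {logv : PadicLogs F} (hlog : LogvAnalytic logv)

open Literature.NumberTheory.NumberFields in
/-- **At EVERY place `v | p`, Dupuy–Hilado's (Ind2) group `Real.ismDH logv v` contains a map expanding some `z ≠ 0` by at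
least `p^{(e_v−1)/e_v}`**: the log-shell `I_v = (p^*)⁻¹·log_p(𝒪_v^×)` has primitive vectors of norms `p^{-n_j/e}` with
`n_j ≡ j (mod e)` for every `j < e` (least `p`-power rescalings of `ϖ^j`), two of them have norm ratio `≥ p^{(e−1)/e}`, and
`Real.ismDH` is transitive on primitive vectors (abc-iut-w5-d180 `exists_mem_ismDH_apply_eq_of_primitive`). The
`ℚ_p`-linear form `g'` and the intertwining through the presentation are recorded as in
`Cor312HullGainRamified.exists_mem_ismDH_norm_lt`. [cite: DupuyHilado2025, §4.9] [cite: NeukirchANT1999, Ch. II Prop. (5.5)] -/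
theorem exists_mem_ismDH_rpow_mul_norm_le (pp : Nat.Primes) [Fact (pp : ℕ).Prime] (v : HeightOneSpectrum (𝓞 F))
    (hv : (thetaIndex X).over (.inr v) = .inr pp) (hvp : ((pp : ℕ) : 𝓞 F) ∈ v.asIdeal) :
    ∃ g ∈ ismDH logv (.inr v : Place F),
      ∃ g' : (presAt X hlog pp).k ⟨.inr v, hv⟩ ≃ₗ[ℚ_[pp]] (presAt X hlog pp).k ⟨.inr v, hv⟩,
        (∀ y, (presAt X hlog pp).φ ⟨.inr v, hv⟩ (g y) = g' ((presAt X hlog pp).φ ⟨.inr v, hv⟩ y)) ∧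
        ∃ z, z ≠ 0 ∧ ((pp : ℕ) : ℝ) ^ (((absRamificationIdx (pp : ℕ) (RescaledCompletion F (pp : ℕ) v hvp) : ℝ) - 1) /
            (absRamificationIdx (pp : ℕ) (RescaledCompletion F (pp : ℕ) v hvp) : ℝ)) * ‖z‖ ≤ ‖g' z‖ := by
  classical
  set K := RescaledCompletion F (pp : ℕ) v hvp with hK
  set e : ℕ := absRamificationIdx (pp : ℕ) K with he
  have hp1 : (1 : ℝ) < (pp : ℕ) := by exact_mod_cast pp.2.one_lt
  have hp0 : (0 : ℝ) < (pp : ℕ) := zero_lt_one.trans hp1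
  have hpQ : ((pp : ℕ) : ℚ_[pp]) ≠ 0 := Nat.cast_ne_zero.mpr pp.2.ne_zero
  have he0 : 0 < e := absRamificationIdx_pos (pp : ℕ) K
  have heR : (0 : ℝ) < e := by exact_mod_cast he0
  haveI : NeZero e := ⟨he0.ne'⟩
  -- the lattice `L = (p^*)⁻¹ · log_p(𝒪_v^×)` (the log-shell read in the rescaled completion)
  set c : ℚ_[pp] := ((pStar (pp : ℕ) : ℕ) : ℚ_[pp])⁻¹ with hc
  have hc0 : c ≠ 0 := inv_ne_zero (Nat.cast_ne_zero.mpr (pStar_ne_zero pp.2.ne_zero))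
  set L : Set K := c • (logUnits K : Set K) with hL
  have hL0 : L ∈ 𝓝 (0 : K) := by
    refine ((isOpen_logUnits (pp : ℕ) K).smul₀ hc0).mem_nhds ?_
    exact ⟨0, (logUnits_compact_open (pp : ℕ) K).2.2, smul_zero _⟩
  have hLb : Bornology.IsBounded L := (isCompact_logUnits (pp : ℕ) K).isBounded.smul₀ c
  -- a uniformiser-like element and its powers, one per class of the value group
  obtain ⟨ϖ, hϖ⟩ := exists_norm_eq_rpow_neg (pp : ℕ) K 1
  rw [← he, Int.cast_one] at hϖ
  have hϖ0 : (ϖ : K) ≠ 0 := ϖ.ne_zero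
  have hu0 : ∀ j : Fin e, ((ϖ : K) ^ (j : ℕ)) ≠ 0 := fun j => pow_ne_zero _ hϖ0
  choose m hm using fun j : Fin e => exists_zpow_smul_mem_and_not_mem (pp : ℕ) hL0 hLb (hu0 j)
  set x : Fin e → K := fun j => (((pp : ℕ) : ℚ_[pp]) ^ m j) • (ϖ : K) ^ (j : ℕ) with hx
  have hx0 : ∀ j, x j ≠ 0 := fun j => smul_ne_zero (zpow_ne_zero _ hpQ) (hu0 j)
  -- the norms: `‖x_j‖ = p^{-(e·m_j + j)/e}`
  set n : Fin e → ℤ := fun j => ((j : ℕ) : ℤ) + (e : ℤ) * m j with hn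
  have hnorm : ∀ j, ‖x j‖ = ((pp : ℕ) : ℝ) ^ (-((n j : ℝ) / (e : ℝ))) := by
    intro j
    rw [hx]
    dsimp only
    rw [norm_smul, norm_zpow, Padic.norm_p, inv_zpow', norm_pow, hϖ, ← Real.rpow_natCast,
      ← Real.rpow_mul hp0.le, ← Real.rpow_intCast, ← Real.rpow_add hp0]
    congr 1
    rw [hn]
    push_cast
    field_simp
    ring
  -- the exponents are pairwise distinct (distinct residues mod `e`)
  have hninj : Function.Injective n := by
    intro j j' hjj'
    have h := congrArg (fun z : ℤ => z % (e : ℤ)) hjj'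
    simp only [hn] at h
    rw [Int.add_mul_emod_self_left, Int.add_mul_emod_self_left] at h
    have hj : ((j : ℕ) : ℤ) % (e : ℤ) = (j : ℕ) := Int.emod_eq_of_lt (by positivity) (by exact_mod_cast j.2)
    have hj' : ((j' : ℕ) : ℤ) % (e : ℤ) = (j' : ℕ) := Int.emod_eq_of_lt (by positivity) (by exact_mod_cast j'.2)
    rw [hj, hj'] at h
    exact Fin.ext (by exact_mod_cast h)
  obtain ⟨jmax, -, hmax⟩ := Finset.exists_max_image Finset.univ n ⟨⟨0, he0⟩, Finset.mem_univ _⟩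
  obtain ⟨jmin, -, hmin⟩ := Finset.exists_min_image Finset.univ n ⟨⟨0, he0⟩, Finset.mem_univ _⟩
  have hspread : (e : ℤ) - 1 ≤ n jmax - n jmin :=
    toNat_spread_of_injective n hninj jmax jmin (fun j => hmax j (Finset.mem_univ _)) (fun j => hmin j (Finset.mem_univ _))
  -- the ratio of the two norms
  have hratio : ((pp : ℕ) : ℝ) ^ (((e : ℝ) - 1) / (e : ℝ)) * ‖x jmax‖ ≤ ‖x jmin‖ := by
    rw [hnorm, hnorm, ← Real.rpow_add hp0]
    refine Real.rpow_le_rpow_of_exponent_le hp1.le ?_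
    have h : ((e : ℤ) : ℝ) - 1 ≤ (n jmax : ℝ) - (n jmin : ℝ) := by exact_mod_cast hspread
    push_cast at h
    rw [show ((e : ℝ) - 1) / (e : ℝ) + -((n jmax : ℝ) / (e : ℝ)) = ((e : ℝ) - 1 - (n jmax : ℝ)) / (e : ℝ) by ring,
      show -((n jmin : ℝ) / (e : ℝ)) = (-(n jmin : ℝ)) / (e : ℝ) by ring]
    exact div_le_div_of_nonneg_right (by linarith) heR.le
  -- both are primitive vectors of `L`
  have hmemL : ∀ j, x j ∈ c • (logUnits K : Set K) := fun j => (hm j).1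
  have hnotL : ∀ j, x j ∉ (((pp : ℕ) : ℚ_[pp]) * c) • (logUnits K : Set K) := by
    intro j hj
    rw [mul_smul] at hj
    have h' := (Set.mem_smul_set_iff_inv_smul_mem₀ hpQ _ _).mp hj
    refine (hm j).2 ?_
    rw [hx] at h'
    dsimp only at h'
    rwa [smul_smul, ← zpow_neg_one, ← zpow_add₀ hpQ, neg_add_eq_sub] at h'
  -- the mover and its `ℚ_p`-linear form
  obtain ⟨g, hg, hgxy⟩ := exists_mem_ismDH_apply_eq_of_primitive (hlog pp) v hvp (hmemL jmax) (hnotL jmax) (hmemL jmin)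
    (hnotL jmin)
  obtain ⟨g', hg'⟩ := (presAt X hlog pp).ism_linear ⟨.inr v, hv⟩ g hg
  have hfun : (fun a => toR (pp : ℕ) v hvp (g (ofR (pp : ℕ) v hvp a))) = ⇑g' := funext fun a => hg' _
  refine ⟨g, hg, g', hg', x jmax, hx0 jmax, ?_⟩
  have hgz : g' (x jmax) = x jmin := by rw [← hgxy]; exact (congrFun hfun (x jmax)).symm
  rw [hgz]
  exact hratio

end Real

end Thm311

end IUTFork

end Summit.ABC

end
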